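import Summits.BirchSwinnertonDyer.BirchSwinnertonDyer.Theorems.ManinLocalTwoThreeManinPrimeToAdditiveFiveLeBistarredKodaira
import Summits.BirchSwinnertonDyer.BirchSwinnertonDyer.Theorems.AdditiveBranchIMCGordTwoRankOneCM
import Literature.NumberTheory.PAdicHodge.DeRhamEllipticPotentiallyGoodOrdinaryRat
import HarnessLib

/-!
# Route `EdixhovenFibreFiveSeven`, crux K★ `StarredOptimalManinUnitFiveSeven` (stmt-BirchSwinnertonDyer-22226),
# line `kato_lever`, stub hDR: **on the potentially ORDINARY half of the K★ locus — the Kodaira cells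
# (5; III*), (7; IV*), (7; II*) — `V_pW|_{Γ_{K_w}}` is de Rham at every place `w ∣ p` of every number field**

The K★ locus is `p ∈ {5, 7}`, additive reduction at `p` (`Addv`), no `Iₙ*` fibre at `p`, `4 < ord_p Δ_min`; by
Tate's algorithm this is the six Kodaira cells `(p; IV*), (p; III*), (p; II*)`, `ord_p Δ_min ∈ {8, 9, 10}`
(`padicValRat_j_nonneg_and_mem_of_starred`). The tree's Kodaira dictionary
(`typeGOrd_iff_eq_nine_of_starred_five`, `typeGOrd_iff_ne_nine_of_starred_seven`; Dokchitser–Dokchitser 2015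
Thm. 3.2 at `l = 5, 7`) says exactly three of them are (G)-ORDINARY (`TypeGOrd`): `(5; III*)` (`j̃ = 1728`,
`5 ≡ 1 (4)`) and `(7; IV*), (7; II*)` (`j̃ = 0`, `7 ≡ 1 (3)`), i.e. `TypeGOrd W p ↔ (p = 5 ↔ ord_p Δ_min = 9)`
(§1). (G)-ordinary is potentially good ordinary reduction at `p`
(`hasPotentiallyGoodOrdinaryReductionAtPrime_of_typeGOrd`), and for such `W/ℚ` the hDR hypothesis of the line —
`GaloisRep.IsDeRham (bdRPeriodRingData hp) (restrictedRationalTateRep W K_w p)` — is the THEOREM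
`isDeRham_restrictedRationalTateRep_adicCompletion_of_potentiallyGoodOrdinary` (Literature
`PAdicHodge/DeRhamEllipticPotentiallyGoodOrdinaryRat`, the de Rham-ness of an extension of an unramified twist of
the cyclotomic character by an unramified character, Kato LNM 1553 II Prop. 1.2.3 engine). §2 assembles this on
the three cells, in the Kodaira-symbol vocabulary of the route decl (`∀ v n, natGenerator v = p → …`).

What this does NOT do: the other three cells `(5; IV*), (5; II*), (7; III*)` are potentially SUPERSINGULAR
(`¬ TypeGOrd`, same dictionary) — there hDR needs both `p`-adic periods (formal-group `∫ω` and Colmez's `∫η`), not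
in the tree; and the line's socket consumes hDR as the universal named fact
`Literature.NumberTheory.PAdicHodge.isDeRham_restrictedRationalTateRep`, not per curve. K★ stays open; BSD is
not proved by any of this. Theorems only; standard axioms.
-/

set_option autoImplicit false
-- the Theorems namespace of this sub repeats the summit name by design (D-0017 nested layout)
set_option linter.dupNamespace false

noncomputable section

open scoped Classical NumberField

namespace Summit.BirchSwinnertonDyer.BirchSwinnertonDyer.Theorems

open Field ValuativeRel WeierstrassCurve IsDedekindDomain NumberField
  Literature.NumberTheory.EllipticCurves Literature.NumberTheory.EllipticCurves.Rank1Residual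
  Literature.NumberTheory.PAdicHodge Literature.NumberTheory.GaloisRepresentations
  Literature.NumberTheory.GaloisRepresentations.IsNonarchimedeanLocalField
  Summit.BirchSwinnertonDyer.Rank1Residual.Additive
  Summit.BirchSwinnertonDyer.BirchSwinnertonDyer.Theorems.AdditiveBranchIMCGordTwoRankOne

variable (W : WeierstrassCurve ℚ) [W.IsElliptic] [W.IsGloballyMinimal] (p : ℕ) [hp : Fact p.Prime]

/-! ## §1 The (G)-ordinary half of the K★ locus -/

/-- **On the K★ locus, (G)-ordinary ⟺ `(p = 5 ↔ ord_p Δ_min = 9)`**: at `5` the (G)-ordinary starred cell is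
`III*` (`ord₅ Δ_min = 9`), at `7` the (G)-ordinary starred cells are `IV*, II*` (`ord₇ Δ_min ≠ 9`).
[cite: DokchitserDokchitser2015LocalInvariants, Thm. 3.2] [cite: SilvermanAEC2009, V.4.1(a) and Exercises V.4.4–4.5] -/
theorem typeGOrd_iff_of_starred_fiveSeven (hp57 : p = 5 ∨ p = 7) (hadd : Addv W p)
    (hI : ∀ n : ℕ, W.kodairaSymbolAt (placeOf p) ≠ .Istar n)
    (hv : 4 < padicValInt p W.minimalDiscriminantInt) :
    TypeGOrd W p ↔ (p = 5 ↔ padicValInt p W.minimalDiscriminantInt = 9) := by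
  rcases hp57 with h5 | h7
  · rw [typeGOrd_iff_eq_nine_of_starred_five W p h5 hadd hI hv]
    exact ⟨fun h ↦ ⟨fun _ ↦ h, fun _ ↦ h5⟩, fun h ↦ h.1 h5⟩
  · rw [typeGOrd_iff_ne_nine_of_starred_seven W p h7 hadd hI hv]
    exact ⟨fun h ↦ ⟨fun h5 ↦ by omega, fun h9 ↦ absurd h9 h⟩, fun h h9 ↦ by have := h.2 h9; omega⟩

/-- **The three (G)-ordinary K★ cells `(5; III*), (7; IV*), (7; II*)` have potentially good ORDINARY reduction at
`p`** (tree sense `HasPotentiallyGoodOrdinaryReductionAtPrime`: good reduction with the unit-root condition at a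
place above `p` of a number field — here a subfield of `ℚ(ζ_p)`).
[cite: DokchitserDokchitser2015LocalInvariants, Thm. 3.2] [cite: SilvermanAEC2009, VII.5.5 and V.4.1(a)] -/
theorem hasPotentiallyGoodOrdinaryReductionAtPrime_of_starred_ordinaryCell
    (hcell : (p = 5 ∧ padicValInt p W.minimalDiscriminantInt = 9) ∨
      (p = 7 ∧ padicValInt p W.minimalDiscriminantInt ≠ 9))
    (hadd : Addv W p) (hI : ∀ n : ℕ, W.kodairaSymbolAt (placeOf p) ≠ .Istar n)
    (hv : 4 < padicValInt p W.minimalDiscriminantInt) :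
    W.HasPotentiallyGoodOrdinaryReductionAtPrime p := by
  have hG : TypeGOrd W p := by
    rcases hcell with ⟨h5, h9⟩ | ⟨h7, h9⟩
    · exact (typeGOrd_iff_eq_nine_of_starred_five W p h5 hadd hI hv).2 h9
    · exact (typeGOrd_iff_ne_nine_of_starred_seven W p h7 hadd hI hv).2 h9
  exact hasPotentiallyGoodOrdinaryReductionAtPrime_of_typeGOrd hG

/-! ## §2 hDR on the (G)-ordinary half of the K★ locus -/

/-- **hDR on the cells `(5; III*), (7; IV*), (7; II*)`: `V_pW|_{Γ_{K'_{w'}}}` is de Rham at every place `w' ∣ p`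
of every number field `K'`** — the instance `K₀ = ℚ`, `F = K'_{w'}` of the line's cite-only hypothesis
`isDeRham_restrictedRationalTateRep`, as a theorem for these curves.
[cite: Kato1993LNM1553, Ch. II Prop. 1.2.3 and Ex. 1.3.5] [cite: BrinonConrad2009, Prop. 6.3.8]
[cite: DokchitserDokchitser2015LocalInvariants, Thm. 3.2] -/
theorem isDeRham_restrictedRationalTateRep_adicCompletion_of_starred_ordinaryCell
    (hcell : (p = 5 ∧ padicValInt p W.minimalDiscriminantInt = 9) ∨
      (p = 7 ∧ padicValInt p W.minimalDiscriminantInt ≠ 9))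
    (hadd : Addv W p) (hI : ∀ n : ℕ, W.kodairaSymbolAt (placeOf p) ≠ .Istar n)
    (hv : 4 < padicValInt p W.minimalDiscriminantInt)
    {K' : Type} [Field K'] [NumberField K'] (w' : HeightOneSpectrum (𝓞 K')) (hw' : (p : 𝓞 K') ∈ w'.asIdeal)
    [CharZero (w'.adicCompletion K')] [Fact (¬ IsUnit (p : integerC (w'.adicCompletion K')))]
    [IsAdicComplete (Ideal.span {(p : integerC (w'.adicCompletion K'))}) (integerC (w'.adicCompletion K'))]
    (hp' : valuation (w'.adicCompletion K') p < 1) [Algebra ℚ_[p] (w'.adicCompletion K')] :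
    GaloisRep.IsDeRham (bdRPeriodRingData (F := w'.adicCompletion K') (p := p) hp')
      (restrictedRationalTateRep W (w'.adicCompletion K') p) :=
  isDeRham_restrictedRationalTateRep_adicCompletion_of_potentiallyGoodOrdinary W
    (hasPotentiallyGoodOrdinaryReductionAtPrime_of_starred_ordinaryCell W p hcell hadd hI hv) w' hw' hp'

/-- **The same in the vocabulary of the route decl `StarredOptimalManinUnitFiveSeven`** (`p = 5 ∨ p = 7`, no `Iₙ*`
fibre at any place of generator `p`, `4 < ord_p Δ_min`), on the (G)-ordinary half `p = 5 ↔ ord_p Δ_min = 9`: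
hDR at the completion `ℚ_v`, `v` the place of `ℚ` above `p`.
[cite: Kato1993LNM1553, Ch. II Prop. 1.2.3 and Ex. 1.3.5] [cite: DokchitserDokchitser2015LocalInvariants, Thm. 3.2] -/
theorem isDeRham_restrictedRationalTateRep_adicCompletion_rat_of_starred_fiveSeven_ordinary
    (hp57 : p = 5 ∨ p = 7) (hadd : Addv W p)
    (hIstar : ∀ (v : HeightOneSpectrum ℤ) (n : ℕ), Rat.HeightOneSpectrum.natGenerator v = p →
      W.kodairaSymbolAt v ≠ .Istar n)
    (hv : 4 < padicValInt p W.minimalDiscriminantInt)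
    (hord : p = 5 ↔ padicValInt p W.minimalDiscriminantInt = 9)
    (v : HeightOneSpectrum (𝓞 ℚ)) (hpv : (p : 𝓞 ℚ) ∈ v.asIdeal)
    [CharZero (v.adicCompletion ℚ)] [Fact (¬ IsUnit (p : integerC (v.adicCompletion ℚ)))]
    [IsAdicComplete (Ideal.span {(p : integerC (v.adicCompletion ℚ))}) (integerC (v.adicCompletion ℚ))]
    (hp' : valuation (v.adicCompletion ℚ) p < 1) [Algebra ℚ_[p] (v.adicCompletion ℚ)] :
    GaloisRep.IsDeRham (bdRPeriodRingData (F := v.adicCompletion ℚ) (p := p) hp')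
      (restrictedRationalTateRep W (v.adicCompletion ℚ) p) := by
  have hgen : Rat.HeightOneSpectrum.natGenerator (placeOf p) = p :=
    congrArg Subtype.val ((Rat.HeightOneSpectrum.primesEquiv (R := ℤ)).apply_symm_apply ⟨p, hp.out⟩)
  have hI : ∀ n : ℕ, W.kodairaSymbolAt (placeOf p) ≠ .Istar n := fun n ↦ hIstar (placeOf p) n hgen
  have hcell : (p = 5 ∧ padicValInt p W.minimalDiscriminantInt = 9) ∨
      (p = 7 ∧ padicValInt p W.minimalDiscriminantInt ≠ 9) := by
    rcases hp57 with h5 | h7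
    · exact Or.inl ⟨h5, hord.1 h5⟩
    · exact Or.inr ⟨h7, fun h9 ↦ by have := hord.2 h9; omega⟩
  exact isDeRham_restrictedRationalTateRep_adicCompletion_rat_of_potentiallyGoodOrdinary W
    (hasPotentiallyGoodOrdinaryReductionAtPrime_of_starred_ordinaryCell W p hcell hadd hI hv) v hpv hp'

/-! ## §3 The general (G)-ordinary form -/

omit [W.IsGloballyMinimal] in
/-- **(G)-ordinary at `p` ⟹ hDR at every `K'_{w'}`, `w' ∣ p`** (any prime `p`, any elliptic `W/ℚ`): Delbourgo's
hypothesis (G) in ordinary form (`TypeGOrd`: good reduction with the unit-root condition over a subfield of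
`ℚ(ζ_p)` at the places above `p`) makes `V_pW|_{Γ_{K'_{w'}}}` de Rham — the form consumed by the additive (G-ord)
programme (`Rank1Residual.Additive`), of which §2 is the K★ instance.
[cite: Kato1993LNM1553, Ch. II Prop. 1.2.3 and Ex. 1.3.5] [cite: BrinonConrad2009, Prop. 6.3.8] -/
theorem isDeRham_restrictedRationalTateRep_adicCompletion_of_typeGOrd (hG : TypeGOrd W p)
    {K' : Type} [Field K'] [NumberField K'] (w' : HeightOneSpectrum (𝓞 K')) (hw' : (p : 𝓞 K') ∈ w'.asIdeal)
    [CharZero (w'.adicCompletion K')] [Fact (¬ IsUnit (p : integerC (w'.adicCompletion K')))]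
    [IsAdicComplete (Ideal.span {(p : integerC (w'.adicCompletion K'))}) (integerC (w'.adicCompletion K'))]
    (hp' : valuation (w'.adicCompletion K') p < 1) [Algebra ℚ_[p] (w'.adicCompletion K')] :
    GaloisRep.IsDeRham (bdRPeriodRingData (F := w'.adicCompletion K') (p := p) hp')
      (restrictedRationalTateRep W (w'.adicCompletion K') p) :=
  isDeRham_restrictedRationalTateRep_adicCompletion_of_potentiallyGoodOrdinary W
    (hasPotentiallyGoodOrdinaryReductionAtPrime_of_typeGOrd hG) w' hw' hp'

omit [W.IsGloballyMinimal] in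
/-- **(G)-ordinary at `p` ⟹ hDR at `ℚ_v`, `v` the place of `ℚ` above `p`** (any prime `p`, any elliptic `W/ℚ`).
[cite: Kato1993LNM1553, Ch. II Prop. 1.2.3 and Ex. 1.3.5] [cite: BrinonConrad2009, Prop. 6.3.8] -/
theorem isDeRham_restrictedRationalTateRep_adicCompletion_rat_of_typeGOrd (hG : TypeGOrd W p)
    (v : HeightOneSpectrum (𝓞 ℚ)) (hpv : (p : 𝓞 ℚ) ∈ v.asIdeal)
    [CharZero (v.adicCompletion ℚ)] [Fact (¬ IsUnit (p : integerC (v.adicCompletion ℚ)))]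
    [IsAdicComplete (Ideal.span {(p : integerC (v.adicCompletion ℚ))}) (integerC (v.adicCompletion ℚ))]
    (hp' : valuation (v.adicCompletion ℚ) p < 1) [Algebra ℚ_[p] (v.adicCompletion ℚ)] :
    GaloisRep.IsDeRham (bdRPeriodRingData (F := v.adicCompletion ℚ) (p := p) hp')
      (restrictedRationalTateRep W (v.adicCompletion ℚ) p) :=
  isDeRham_restrictedRationalTateRep_adicCompletion_rat_of_potentiallyGoodOrdinary W
    (hasPotentiallyGoodOrdinaryReductionAtPrime_of_typeGOrd hG) v hpv hp'

end Summit.BirchSwinnertonDyer.BirchSwinnertonDyer.Theorems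

end
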